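import Literature.Analysis.FluidPDE.NSRobustnessOfRegularity
import Literature.Analysis.FluidPDE.ClassicalL2StabilityStrain
import Literature.Analysis.FluidPDE.BKMClassTimeDerivativeL2
import Literature.Analysis.FluidPDE.KatoCaloricField
import Literature.Analysis.FluidPDE.LerayHopfProofs
import Literature.Analysis.FunctionSpaces.TorusClassicalNSBackwardUniqueness
import HarnessLib

/-!
# Backward uniqueness of classical Navier–Stokes solutions on `ℝ³` in the `L²`-Sobolev class

Support file (all results proved; no definitions, no named facts) for the accepted notion
`IsClassicalNSSolutionOn S ν f u p` (`ClassicalSolution`) in Tao's quantitative class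
(`HasBoundedSobolevNormsOn`: all `L²`-Sobolev norms of the velocity, of its time derivative and of
the pressure bounded on the time interval). Main result:

* `IsClassicalNSSolutionOn.velocity_backward_unique_R3` — two such solutions on `[0, T] × ℝ³` with
  the same viscosity `ν > 0` and zero force which **agree at the final time** `t = T` agree on all
  of `[0, T]` (Temam 1997, Ch. III §6; Constantin–Foias 1988, Ch. 12, Theorem 12.2: injectivity of
  the solution map). This is the whole-space analogue of
  `Torus.IsClassicalNSSolutionOn.velocity_backward_unique` (`TorusClassicalNSBackwardUniqueness`);
  unlike `IsClassicalNSSolutionOn.backward_unique` (`BackwardEnergyUniqueness`) it needs no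
  pointwise uniform spatial decay, only the `L²`-Sobolev class, which classical solutions from
  Schwartz data enjoy (`TaoLocalisationHolds`).

Proof road (log-convexity / Dirichlet quotient, Temam 1997 Ch. III §6.1 Lemmas 6.1–6.2 applied as
in §6.2 (6.16)–(6.17)): for `w = v − u`, `E = ∫‖w‖²`, `X = ∫|∇w|²_F`,
`E' = −2νX − 2∫⟪(w·∇)u, w⟫` (the `L²` balance `IsSmoothSpaceTimeOn.l2_balance` with the slice
identity `l2_slice_strain_identity`) and `X' = −2ν∫‖Δw‖² + 2∫⟪(v·∇)w + (w·∇)u, Δw⟫`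
(`IsClassicalNSSolutionOn.enstrophy_sub_balance_forces`); Young's inequality
(`integral_inner_laplacian_add_smul_le_R3`), Green's identity `∫⟪Δw, w⟫ = −X`
(`integral_inner_laplacian_self_of_l2`) and `∫⟪(v·∇)w, w⟫ = 0` give the Dirichlet-quotient law
`X'E − XE' ≤ K(X + E)E`, `K = (M² + L²)/ν`, and `Literature.Analysis.ODE.eq_zero_of_dirichletQuotient_law`
concludes. The time derivatives are taken *within* `[0, T]` at every point including the
endpoints: each balance law `Φ(b) = Φ(0) + ∫₀ᵇ φ` is combined with the continuity of its flux `φ`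
on `[0, T]` (`hasDerivWithinAt_Icc_of_eq_add_intervalIntegral`), the flux continuity coming from
`C([0,T]; L²)` of `w`, `Δw`, `(w·∇)u`, `(v·∇)w` (`IsSmoothSpaceTimeOn.continuousInLpOn_two`: an
`L²` bound on the time derivative gives `L²`-Lipschitz continuity in time) and the continuity of
`L²` pairings (`ContinuousInLpOn.continuousOn_integral_inner_pair`).

Public by-products: `IsSmoothSpaceTimeOn.continuousInLpOn_two` and
`ContinuousInLpOn.continuousOn_integral_inner_pair`; the remaining helpers (time derivatives of
spatial derivatives / products of smooth space-time fields, `L²` bookkeeping, the FTC step) are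
private.

References: R. Temam, *Infinite-Dimensional Dynamical Systems in Mechanics and Physics*, 2nd ed.,
Springer 1997, Ch. III §6; P. Constantin, C. Foias, *Navier–Stokes Equations*, Chicago 1988,
Ch. 12; A. Majda, A. Bertozzi, *Vorticity and Incompressible Flow*, CUP 2002, §3.1.
-/

open MeasureTheory Set Function Filter Topology InnerProductSpace
open scoped ENNReal NNReal ContDiff RealInnerProductSpace Laplacian

noncomputable section

namespace Literature.Analysis.FluidPDE

/-! ## Generic tools: `C(S; L²)` from an `L²` bound on the time derivative, pairings -/

section L2Continuity

variable {F : Type*} [NormedAddCommGroup F] [NormedSpace ℝ F] [CompleteSpace F]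

/-- **`C([a, b]; L²)` from the class bounds.** A field jointly smooth on `[a, b] × ℝ³` whose
slices and one-sided time derivatives are bounded in `L²(ℝ³)` uniformly on `[a, b]` is continuous
into `L²` on `[a, b]`: `‖w(t) − w(s)‖₂ ≤ |t − s| Λ^{1/2}`
(`IsSmoothSpaceTimeOn.lintegral_enorm_sub_sq_le`). [cite: MajdaBertozziCUP2002, §3.2.2 Thm. 3.5 (continuity in the high norm; PDF p. 92)] -/
theorem IsSmoothSpaceTimeOn.continuousInLpOn_two {a b : ℝ} (hab : a < b)
    {A : ℝ → EuclideanSpace ℝ (Fin 3) → F} (h : IsSmoothSpaceTimeOn (Icc a b) A) {C Λ : ℝ≥0}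
    (hC : ∀ τ ∈ Icc a b, ∫⁻ x, ‖A τ x‖ₑ ^ 2 ≤ C)
    (hΛ : ∀ τ ∈ Icc a b, ∫⁻ x, ‖FluidPDE.timeDerivWithin (Icc a b) A τ x‖ₑ ^ 2 ≤ Λ) :
    ContinuousInLpOn (Icc a b) 2 A := by
  have hmem : ∀ t ∈ Icc a b, MemLp (A t) 2 volume := fun t ht =>
    ⟨(h.contDiff_slice ht).continuous.aestronglyMeasurable,
      eLpNorm_two_lt_top_of_lintegral_enorm_sq_lt_top ((hC t ht).trans_lt ENNReal.coe_lt_top)⟩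
  refine ⟨hmem, fun t₀ ht₀ => ?_⟩
  have hlip : ∀ t ∈ Icc a b,
      ∫⁻ x, ‖A t x - A t₀ x‖ₑ ^ 2 ≤ ENNReal.ofReal ((t - t₀) ^ 2) * Λ := by
    intro t ht
    rcases le_total t₀ t with hle | hle
    · exact h.lintegral_enorm_sub_sq_le hab hΛ ht₀ ht hle
    · have e : ∀ x, ‖A t x - A t₀ x‖ₑ = ‖A t₀ x - A t x‖ₑ := fun x => by
        rw [← enorm_neg, neg_sub]
      simp_rw [e]
      rw [show (t - t₀) ^ 2 = (t₀ - t) ^ 2 by ring]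
      exact h.lintegral_enorm_sub_sq_le hab hΛ ht ht₀ hle
  have hbound : ∀ t ∈ Icc a b, eLpNorm (A t - A t₀) 2 volume ≤
      ENNReal.ofReal |t - t₀| * (Λ : ℝ≥0∞) ^ (1 / 2 : ℝ) := by
    intro t ht
    have h1 : eLpNorm (A t - A t₀) 2 volume ≤
        (ENNReal.ofReal ((t - t₀) ^ 2) * Λ) ^ (1 / 2 : ℝ) :=
      eLpNorm_two_le_rpow_of_lintegral_sq_le (hlip t ht)
    have h2 : (ENNReal.ofReal ((t - t₀) ^ 2) * Λ) ^ (1 / 2 : ℝ) =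
        ENNReal.ofReal |t - t₀| * (Λ : ℝ≥0∞) ^ (1 / 2 : ℝ) := by
      rw [ENNReal.mul_rpow_of_nonneg _ _ (by norm_num : (0 : ℝ) ≤ 1 / 2),
        ENNReal.ofReal_rpow_of_nonneg (sq_nonneg _) (by norm_num : (0 : ℝ) ≤ 1 / 2),
        ← Real.sqrt_eq_rpow, Real.sqrt_sq_eq_abs]
    rw [h2] at h1
    exact h1
  have h0 : Tendsto (fun t : ℝ => |t - t₀|) (𝓝 t₀) (𝓝 0) := by
    have hc : Continuous fun t : ℝ => |t - t₀| := (continuous_id.sub continuous_const).abs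
    have := hc.tendsto t₀
    simpa using this
  have h1 : Tendsto (fun t => ENNReal.ofReal |t - t₀|) (𝓝[Icc a b] t₀) (𝓝 0) := by
    have := (ENNReal.tendsto_ofReal h0).mono_left (nhdsWithin_le_nhds (s := Icc a b))
    rwa [ENNReal.ofReal_zero] at this
  have h2 : Tendsto (fun t => ENNReal.ofReal |t - t₀| * (Λ : ℝ≥0∞) ^ (1 / 2 : ℝ))
      (𝓝[Icc a b] t₀) (𝓝 0) := by
    have hne : (Λ : ℝ≥0∞) ^ (1 / 2 : ℝ) ≠ ⊤ :=
      ENNReal.rpow_ne_top_of_nonneg (by norm_num : (0 : ℝ) ≤ 1 / 2) ENNReal.coe_ne_top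
    have := ENNReal.Tendsto.mul_const h1 (Or.inr hne)
    rwa [zero_mul] at this
  refine tendsto_of_tendsto_of_tendsto_of_le_of_le' tendsto_const_nhds h2
    (Eventually.of_forall fun t => zero_le) ?_
  exact eventually_mem_nhdsWithin.mono fun t ht => hbound t ht

end L2Continuity

section Pairing

variable {X : Type*} [MeasureSpace X]
variable {G : Type*} [NormedAddCommGroup G] [InnerProductSpace ℝ G]

/-- **Pairings of `C(S; L²)` fields are continuous**: if `A, B ∈ C(S; L²)` then
`t ↦ ∫⟪A(t), B(t)⟫` is continuous on `S` (continuity of the inner product of the Hilbert space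
`L²`, via the lifts `ContinuousInLpOn.exists_continuousOn_toLp`). [cite: RobinsonRodrigoSadowski2016, §1.7] -/
theorem ContinuousInLpOn.continuousOn_integral_inner_pair {S : Set ℝ} {A B : ℝ → X → G}
    (hA : ContinuousInLpOn S 2 A) (hB : ContinuousInLpOn S 2 B) :
    ContinuousOn (fun t => ∫ x, ⟪A t x, B t x⟫) S := by
  obtain ⟨U, hUc, hU⟩ := hA.exists_continuousOn_toLp
  obtain ⟨V, hVc, hV⟩ := hB.exists_continuousOn_toLp
  have hc : ContinuousOn (fun t => ⟪U t, V t⟫) S := hUc.inner hVc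
  refine hc.congr fun t ht => ?_
  show ∫ x, ⟪A t x, B t x⟫ = ⟪U t, V t⟫
  rw [hU t ht, hV t ht, MeasureTheory.L2.inner_def]
  refine integral_congr_ae ?_
  filter_upwards [(hA.1 t ht).coeFn_toLp, (hB.1 t ht).coeFn_toLp] with x ha hb
  rw [ha, hb]

end Pairing

section LintegralHelpers

variable {α : Type*} [MeasurableSpace α] {μ : Measure α}
variable {G G₁ G₂ : Type*} [NormedAddCommGroup G] [NormedAddCommGroup G₁] [NormedAddCommGroup G₂]

omit [MeasurableSpace α] in
/-- Pointwise: `‖y‖ ≤ c₁‖y₁‖ + c₂‖y₂‖` gives `‖y‖ₑ² ≤ 2c₁²‖y₁‖ₑ² + 2c₂²‖y₂‖ₑ²`. [folklore] -/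
private theorem enorm_sq_le_of_norm_le_two {y : G} {y₁ : G₁} {y₂ : G₂} {c₁ c₂ : ℝ} (hc₁ : 0 ≤ c₁)
    (hc₂ : 0 ≤ c₂) (h : ‖y‖ ≤ c₁ * ‖y₁‖ + c₂ * ‖y₂‖) :
    ‖y‖ₑ ^ 2 ≤ 2 * ENNReal.ofReal (c₁ ^ 2) * ‖y₁‖ₑ ^ 2 +
      2 * ENNReal.ofReal (c₂ ^ 2) * ‖y₂‖ₑ ^ 2 := by
  have h1 : ‖y‖ ^ 2 ≤ 2 * c₁ ^ 2 * ‖y₁‖ ^ 2 + 2 * c₂ ^ 2 * ‖y₂‖ ^ 2 := by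
    have ha : 0 ≤ c₁ * ‖y₁‖ := mul_nonneg hc₁ (norm_nonneg _)
    have hb : 0 ≤ c₂ * ‖y₂‖ := mul_nonneg hc₂ (norm_nonneg _)
    nlinarith [h, norm_nonneg y, sq_nonneg (c₁ * ‖y₁‖ - c₂ * ‖y₂‖)]
  have e0 : ‖y‖ₑ ^ 2 = ENNReal.ofReal (‖y‖ ^ 2) := by
    rw [ENNReal.ofReal_pow (norm_nonneg _), ofReal_norm]
  have e1 : ‖y₁‖ₑ ^ 2 = ENNReal.ofReal (‖y₁‖ ^ 2) := by
    rw [ENNReal.ofReal_pow (norm_nonneg _), ofReal_norm]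
  have e2 : ‖y₂‖ₑ ^ 2 = ENNReal.ofReal (‖y₂‖ ^ 2) := by
    rw [ENNReal.ofReal_pow (norm_nonneg _), ofReal_norm]
  rw [e0, e1, e2]
  have e3 : (2 : ℝ≥0∞) * ENNReal.ofReal (c₁ ^ 2) * ENNReal.ofReal (‖y₁‖ ^ 2) +
      2 * ENNReal.ofReal (c₂ ^ 2) * ENNReal.ofReal (‖y₂‖ ^ 2) =
      ENNReal.ofReal (2 * c₁ ^ 2 * ‖y₁‖ ^ 2 + 2 * c₂ ^ 2 * ‖y₂‖ ^ 2) := by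
    rw [ENNReal.ofReal_add (by positivity) (by positivity),
      ENNReal.ofReal_mul (by positivity : (0 : ℝ) ≤ 2 * c₁ ^ 2),
      ENNReal.ofReal_mul (by positivity : (0 : ℝ) ≤ 2 * c₂ ^ 2),
      ENNReal.ofReal_mul (zero_le_two : (0 : ℝ) ≤ 2),
      ENNReal.ofReal_mul (zero_le_two : (0 : ℝ) ≤ 2), ENNReal.ofReal_ofNat]
  rw [e3]
  exact ENNReal.ofReal_le_ofReal h1

/-- `∫⁻‖g‖ₑ² ≤ 2c₁² ∫⁻‖h₁‖ₑ² + 2c₂² ∫⁻‖h₂‖ₑ²` when `‖g‖ ≤ c₁‖h₁‖ + c₂‖h₂‖` pointwise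
(`h₁` measurable). [folklore] -/
private theorem lintegral_enorm_sq_le_of_norm_le_two {g : α → G} {h₁ : α → G₁} {h₂ : α → G₂}
    {c₁ c₂ : ℝ} (hc₁ : 0 ≤ c₁) (hc₂ : 0 ≤ c₂) (h : ∀ x, ‖g x‖ ≤ c₁ * ‖h₁ x‖ + c₂ * ‖h₂ x‖)
    (hm : AEStronglyMeasurable h₁ μ) :
    ∫⁻ x, ‖g x‖ₑ ^ 2 ∂μ ≤ 2 * ENNReal.ofReal (c₁ ^ 2) * ∫⁻ x, ‖h₁ x‖ₑ ^ 2 ∂μ +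
      2 * ENNReal.ofReal (c₂ ^ 2) * ∫⁻ x, ‖h₂ x‖ₑ ^ 2 ∂μ := by
  calc ∫⁻ x, ‖g x‖ₑ ^ 2 ∂μ
      ≤ ∫⁻ x, (2 * ENNReal.ofReal (c₁ ^ 2) * ‖h₁ x‖ₑ ^ 2 +
          2 * ENNReal.ofReal (c₂ ^ 2) * ‖h₂ x‖ₑ ^ 2) ∂μ :=
        lintegral_mono fun x => enorm_sq_le_of_norm_le_two hc₁ hc₂ (h x)
    _ = 2 * ENNReal.ofReal (c₁ ^ 2) * ∫⁻ x, ‖h₁ x‖ₑ ^ 2 ∂μ +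
          2 * ENNReal.ofReal (c₂ ^ 2) * ∫⁻ x, ‖h₂ x‖ₑ ^ 2 ∂μ := by
        rw [lintegral_add_left' ((hm.enorm.pow_const 2).const_mul _),
          lintegral_const_mul' _ _ (ENNReal.mul_ne_top (by simp) ENNReal.ofReal_ne_top),
          lintegral_const_mul' _ _ (ENNReal.mul_ne_top (by simp) ENNReal.ofReal_ne_top)]

end LintegralHelpers

section FTC

/-- FTC within `[0, T]`: if `Φ(b) = Φ(0) + ∫₀ᵇ φ` on `[0, T]` with `φ` continuous on `[0, T]`, then
`Φ` has the one-sided derivative `φ(t)` within `[0, T]` at every `t ∈ [0, T]`. [folklore] -/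
private theorem hasDerivWithinAt_Icc_of_eq_add_intervalIntegral {φ Φ : ℝ → ℝ} {T : ℝ}
    (hφ : ContinuousOn φ (Icc 0 T)) (hΦ : ∀ b ∈ Icc 0 T, Φ b = Φ 0 + ∫ s in (0 : ℝ)..b, φ s)
    {t : ℝ} (ht : t ∈ Icc 0 T) : HasDerivWithinAt Φ (φ t) (Icc 0 T) t := by
  haveI : Fact (t ∈ Icc 0 T) := ⟨ht⟩
  have hint : IntervalIntegrable φ volume 0 t :=
    (hφ.mono (Icc_subset_Icc_right ht.2)).intervalIntegrable_of_Icc ht.1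
  have h : HasDerivWithinAt (fun r => ∫ x in (0 : ℝ)..r, φ x) (φ t) (Icc 0 T) t :=
    intervalIntegral.integral_hasDerivWithinAt_right hint
      (hφ.stronglyMeasurableAtFilter_nhdsWithin measurableSet_Icc t) (hφ t ht)
  have h2 : HasDerivWithinAt (fun r => Φ 0 + ∫ x in (0 : ℝ)..r, φ x) (φ t) (Icc 0 T) t :=
    h.const_add _
  exact h2.congr_of_mem (fun r hr => hΦ r hr) ht

end FTC

/-! ## Time derivatives of slice Laplacians and convective terms -/

section TimeDerivatives

variable {E : Type*} [NormedAddCommGroup E] [InnerProductSpace ℝ E] [FiniteDimensional ℝ E]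
variable {F' : Type*} [NormedAddCommGroup F'] [InnerProductSpace ℝ F']
variable {S : Set ℝ}

omit [FiniteDimensional ℝ E] in
/-- The time derivative of the slice derivative, as operators: `∂ₜ(D(c t)(x)) = D(∂ₜc(t))(x)`
(`S` of unique differentiability inside the closure of its interior). [folklore] -/
private theorem IsSmoothSpaceTimeOn.timeDerivWithin_fderiv_slice {c : ℝ → E → F'}
    (hc : IsSmoothSpaceTimeOn S c) (hS : UniqueDiffOn ℝ S) (hcl : S ⊆ closure (interior S))
    {t : ℝ} (ht : t ∈ S) (x : E) :
    FluidPDE.timeDerivWithin S (fun s y => fderiv ℝ (c s) y) t x = fderiv ℝ (FluidPDE.timeDerivWithin S c t) x := by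
  ext e
  have h1 := (hc.fderiv_slice hS).timeDerivWithin_clm_comp hS
    (ContinuousLinearMap.apply ℝ F' e) ht x
  simp only [ContinuousLinearMap.apply_apply] at h1
  rw [← h1]
  exact hc.timeDerivWithin_fderiv_slice_apply hS hcl ht x e

omit [FiniteDimensional ℝ E] in
/-- **Product rule for the convective term**: `∂ₜ((a·∇)c) = (a·∇)∂ₜc + (∂ₜa·∇)c` for jointly
smooth fields (`S` of unique differentiability inside the closure of its interior). [folklore] -/
private theorem IsSmoothSpaceTimeOn.timeDerivWithin_convect {a : ℝ → E → E} {c : ℝ → E → F'}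
    (ha : IsSmoothSpaceTimeOn S a) (hc : IsSmoothSpaceTimeOn S c) (hS : UniqueDiffOn ℝ S)
    (hcl : S ⊆ closure (interior S)) {t : ℝ} (ht : t ∈ S) (x : E) :
    FluidPDE.timeDerivWithin S (fun s y => FluidPDE.convect (a s) (c s) y) t x =
      FluidPDE.convect (a t) (FluidPDE.timeDerivWithin S c t) x + FluidPDE.convect (FluidPDE.timeDerivWithin S a t) (c t) x := by
  have hF : HasDerivWithinAt (fun s => fderiv ℝ (c s) x)
      (FluidPDE.timeDerivWithin S (fun s y => fderiv ℝ (c s) y) t x) S t :=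
    (hc.fderiv_slice hS).hasDerivWithinAt_timeDerivWithin hS ht x
  rw [hc.timeDerivWithin_fderiv_slice hS hcl ht x] at hF
  have hg : HasDerivWithinAt (fun s => a s x) (FluidPDE.timeDerivWithin S a t x) S t :=
    ha.hasDerivWithinAt_timeDerivWithin hS ht x
  have h := hF.clm_apply hg
  rw [timeDerivWithin_apply]
  simp only [FluidPDE.convect]
  exact h.derivWithin (hS t ht)

/-- **Time derivative of the slice Laplacian**: `∂ₜ(Δ(c t))(x) = Δ(∂ₜc(t))(x)` for a jointly
smooth field (`Δ = Σᵢ ∂ᵢ∂ᵢ` and `IsSmoothSpaceTimeOn.timeDerivWithin_fderiv_slice_apply` twice).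
[folklore] -/
private theorem IsSmoothSpaceTimeOn.timeDerivWithin_laplacian {c : ℝ → E → F'}
    (hc : IsSmoothSpaceTimeOn S c) (hS : UniqueDiffOn ℝ S) (hcl : S ⊆ closure (interior S))
    {t : ℝ} (ht : t ∈ S) (x : E) :
    FluidPDE.timeDerivWithin S (fun s y => (Δ (c s)) y) t x = (Δ (FluidPDE.timeDerivWithin S c t)) x := by
  set b := stdOrthonormalBasis ℝ E
  have h1 : ∀ i, IsSmoothSpaceTimeOn S (fun s y => fderiv ℝ (c s) y (b i)) := fun i =>
    hc.fderiv_slice_apply hS (b i)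
  have h2 : ∀ i, IsSmoothSpaceTimeOn S
      (fun s y => fderiv ℝ (fun z => fderiv ℝ (c s) z (b i)) y (b i)) := fun i =>
    (h1 i).fderiv_slice_apply hS (b i)
  have hG : ∀ i, FluidPDE.timeDerivWithin S (fun s y => fderiv ℝ (fun z => fderiv ℝ (c s) z (b i)) y (b i))
      t x = fderiv ℝ (fun z => fderiv ℝ (FluidPDE.timeDerivWithin S c t) z (b i)) x (b i) := by
    intro i
    rw [(h1 i).timeDerivWithin_fderiv_slice_apply hS hcl ht x (b i)]
    have heq : FluidPDE.timeDerivWithin S (fun s y => fderiv ℝ (c s) y (b i)) t =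
        fun z => fderiv ℝ (FluidPDE.timeDerivWithin S c t) z (b i) :=
      funext fun z => hc.timeDerivWithin_fderiv_slice_apply hS hcl ht z (b i)
    rw [heq]
  have hsum : HasDerivWithinAt (fun s => ∑ i, fderiv ℝ (fun z => fderiv ℝ (c s) z (b i)) x (b i))
      (∑ i, fderiv ℝ (fun z => fderiv ℝ (FluidPDE.timeDerivWithin S c t) z (b i)) x (b i)) S t := by
    have h := HasDerivWithinAt.fun_sum (u := Finset.univ)
      fun i _ => (h2 i).hasDerivWithinAt_timeDerivWithin hS ht x
    refine (h.congr_deriv ?_)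
    exact Finset.sum_congr rfl fun i _ => hG i
  have h2c : ∀ s ∈ S, ContDiff ℝ 2 (c s) := fun s hs => (hc.contDiff_slice hs).of_le (by norm_cast)
  have h2d : ContDiff ℝ 2 (FluidPDE.timeDerivWithin S c t) :=
    ((hc.timeDerivWithin hS).contDiff_slice ht).of_le (by norm_cast)
  rw [timeDerivWithin_apply]
  have hcongr : derivWithin (fun s => (Δ (c s)) x) S t =
      derivWithin (fun s => ∑ i, fderiv ℝ (fun z => fderiv ℝ (c s) z (b i)) x (b i)) S t :=
    derivWithin_congr (fun s hs => laplacian_eq_sum_fderiv_fderiv b (h2c s hs) x)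
      (laplacian_eq_sum_fderiv_fderiv b (h2c t ht) x)
  rw [hcongr, hsum.derivWithin (hS t ht), laplacian_eq_sum_fderiv_fderiv b h2d x]

end TimeDerivatives

/-! ## `C(S; Lᵖ)`: sums -/

section LpAdd

variable {X : Type*} [MeasureSpace X] {F : Type*} [NormedAddCommGroup F]

/-- Sums of `C(S; Lᵖ)` fields are `C(S; Lᵖ)` (`1 ≤ p`). [folklore] -/
private theorem ContinuousInLpOn.add {S : Set ℝ} {p : ℝ≥0∞} (hp : 1 ≤ p) {u w : ℝ → X → F}
    (hu : ContinuousInLpOn S p u) (hw : ContinuousInLpOn S p w) :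
    ContinuousInLpOn S p (fun t x => u t x + w t x) := by
  refine ⟨fun t ht => (hu.1 t ht).add (hw.1 t ht), fun t₀ ht₀ => ?_⟩
  have h := (hu.2 t₀ ht₀).add (hw.2 t₀ ht₀)
  rw [add_zero] at h
  refine tendsto_of_tendsto_of_tendsto_of_le_of_le' tendsto_const_nhds h
    (Eventually.of_forall fun t => zero_le) ?_
  filter_upwards [self_mem_nhdsWithin] with t ht
  have e1 : (fun x => u t x + w t x) - (fun x => u t₀ x + w t₀ x) =
      (u t - u t₀) + (w t - w t₀) := by
    funext x; simp only [Pi.sub_apply, Pi.add_apply]; abel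
  rw [e1]
  exact eLpNorm_add_le ((hu.1 t ht).sub (hu.1 t₀ ht₀)).aestronglyMeasurable
    ((hw.1 t ht).sub (hw.1 t₀ ht₀)).aestronglyMeasurable hp

end LpAdd

/-! ## `L²`-class bookkeeping on `ℝ³` -/

section ClassHelpers

variable {α : Type*} [MeasurableSpace α] {μ : Measure α}
variable {G G₁ G₂ : Type*} [NormedAddCommGroup G] [NormedAddCommGroup G₁] [NormedAddCommGroup G₂]

/-- `∫⁻‖g‖ₑ² ≤ c² K` (as an `ℝ≥0` constant) when `‖g‖ ≤ c‖h‖` pointwise and `∫⁻‖h‖ₑ² ≤ K`.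
[folklore] -/
private theorem lintegral_enorm_sq_le_coe_of_norm_le_mul {g : α → G} {h : α → G₁} {c : ℝ} {K : ℝ≥0}
    (hle : ∀ x, ‖g x‖ ≤ c * ‖h x‖) (hK : ∫⁻ x, ‖h x‖ₑ ^ 2 ∂μ ≤ K) :
    ∫⁻ x, ‖g x‖ₑ ^ 2 ∂μ ≤ (((c ^ 2).toNNReal * K : ℝ≥0) : ℝ≥0∞) := by
  have hpt : ∀ x, ‖g x‖ₑ ^ 2 ≤ ENNReal.ofReal (c ^ 2) * ‖h x‖ₑ ^ 2 := by
    intro x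
    have h1 : ‖g x‖ ^ 2 ≤ c ^ 2 * ‖h x‖ ^ 2 := by
      rw [← mul_pow]
      exact pow_le_pow_left₀ (norm_nonneg _) (hle x) 2
    have e0 : ‖g x‖ₑ ^ 2 = ENNReal.ofReal (‖g x‖ ^ 2) := by
      rw [ENNReal.ofReal_pow (norm_nonneg _), ofReal_norm]
    have e1 : ‖h x‖ₑ ^ 2 = ENNReal.ofReal (‖h x‖ ^ 2) := by
      rw [ENNReal.ofReal_pow (norm_nonneg _), ofReal_norm]
    rw [e0, e1, ← ENNReal.ofReal_mul (sq_nonneg c)]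
    exact ENNReal.ofReal_le_ofReal h1
  calc ∫⁻ x, ‖g x‖ₑ ^ 2 ∂μ ≤ ∫⁻ x, ENNReal.ofReal (c ^ 2) * ‖h x‖ₑ ^ 2 ∂μ := lintegral_mono hpt
    _ = ENNReal.ofReal (c ^ 2) * ∫⁻ x, ‖h x‖ₑ ^ 2 ∂μ :=
        lintegral_const_mul' _ _ ENNReal.ofReal_ne_top
    _ ≤ (((c ^ 2).toNNReal * K : ℝ≥0) : ℝ≥0∞) := by
        rw [ENNReal.coe_mul]
        exact mul_le_mul' le_rfl hK

/-- Two-term version: `‖g‖ ≤ c₁‖h₁‖ + c₂‖h₂‖`, `∫⁻‖hᵢ‖ₑ² ≤ Kᵢ` give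
`∫⁻‖g‖ₑ² ≤ 2c₁²K₁ + 2c₂²K₂`. [folklore] -/
private theorem lintegral_enorm_sq_le_coe_of_norm_le_two {g : α → G} {h₁ : α → G₁} {h₂ : α → G₂}
    {c₁ c₂ : ℝ} {K₁ K₂ : ℝ≥0} (hc₁ : 0 ≤ c₁) (hc₂ : 0 ≤ c₂)
    (hle : ∀ x, ‖g x‖ ≤ c₁ * ‖h₁ x‖ + c₂ * ‖h₂ x‖) (hm : AEStronglyMeasurable h₁ μ)
    (hK₁ : ∫⁻ x, ‖h₁ x‖ₑ ^ 2 ∂μ ≤ K₁) (hK₂ : ∫⁻ x, ‖h₂ x‖ₑ ^ 2 ∂μ ≤ K₂) :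
    ∫⁻ x, ‖g x‖ₑ ^ 2 ∂μ ≤
      ((2 * (c₁ ^ 2).toNNReal * K₁ + 2 * (c₂ ^ 2).toNNReal * K₂ : ℝ≥0) : ℝ≥0∞) := by
  refine (lintegral_enorm_sq_le_of_norm_le_two hc₁ hc₂ hle hm).trans ?_
  have e : ((2 * (c₁ ^ 2).toNNReal * K₁ + 2 * (c₂ ^ 2).toNNReal * K₂ : ℝ≥0) : ℝ≥0∞) =
      2 * ENNReal.ofReal (c₁ ^ 2) * K₁ + 2 * ENNReal.ofReal (c₂ ^ 2) * K₂ := by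
    simp only [ENNReal.ofReal, ENNReal.coe_add, ENNReal.coe_mul, ENNReal.coe_ofNat]
  rw [e]
  gcongr

variable {F : Type*} [NormedAddCommGroup F] [NormedSpace ℝ F]

omit [MeasurableSpace α] in
/-- Uniform `L²`-Sobolev bounds pass to slicewise differences. [folklore] -/
private theorem bu_sobolev_sub {S : Set ℝ} {a b c : ℝ → EuclideanSpace ℝ (Fin 3) → F}
    (habc : ∀ t ∈ S, ∀ x, c t x = a t x - b t x) (ha : ∀ t ∈ S, ContDiff ℝ ∞ (a t))
    (hb : ∀ t ∈ S, ContDiff ℝ ∞ (b t))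
    (hA : ∀ n : ℕ, ∃ C : ℝ≥0, ∀ t ∈ S, ∫⁻ x, ‖iteratedFDeriv ℝ n (a t) x‖ₑ ^ 2 ≤ C)
    (hB : ∀ n : ℕ, ∃ C : ℝ≥0, ∀ t ∈ S, ∫⁻ x, ‖iteratedFDeriv ℝ n (b t) x‖ₑ ^ 2 ≤ C) (n : ℕ) :
    ∃ C : ℝ≥0, ∀ t ∈ S, ∫⁻ x, ‖iteratedFDeriv ℝ n (c t) x‖ₑ ^ 2 ≤ C := by
  obtain ⟨Ca, hCa⟩ := hA n
  obtain ⟨Cb, hCb⟩ := hB n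
  refine ⟨2 * Ca + 2 * Cb, fun t ht => ?_⟩
  have hc : c t = a t - b t := funext fun x => by rw [Pi.sub_apply, habc t ht x]
  have hsub : ∀ x, iteratedFDeriv ℝ n (c t) x =
      iteratedFDeriv ℝ n (a t) x - iteratedFDeriv ℝ n (b t) x := fun x => by
    rw [hc]
    exact iteratedFDeriv_sub_apply ((ha t ht).of_le (by exact_mod_cast le_top)).contDiffAt
      ((hb t ht).of_le (by exact_mod_cast le_top)).contDiffAt
  have hm : AEStronglyMeasurable (fun x => iteratedFDeriv ℝ n (a t) x) volume :=
    ((ha t ht).continuous_iteratedFDeriv (by exact_mod_cast le_top)).aestronglyMeasurable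
  calc ∫⁻ x, ‖iteratedFDeriv ℝ n (c t) x‖ₑ ^ 2
      = ∫⁻ x, ‖iteratedFDeriv ℝ n (a t) x - iteratedFDeriv ℝ n (b t) x‖ₑ ^ 2 :=
        lintegral_congr fun x => by rw [hsub]
    _ ≤ 2 * (∫⁻ x, ‖iteratedFDeriv ℝ n (a t) x‖ₑ ^ 2) +
          2 * ∫⁻ x, ‖iteratedFDeriv ℝ n (b t) x‖ₑ ^ 2 := lintegral_enorm_sq_sub_le hm
    _ ≤ 2 * (Ca : ℝ≥0∞) + 2 * (Cb : ℝ≥0∞) := by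
        gcongr
        · exact hCa t ht
        · exact hCb t ht
    _ = ((2 * Ca + 2 * Cb : ℝ≥0) : ℝ≥0∞) := by push_cast; rfl

omit [MeasurableSpace α] in
/-- Order-zero Sobolev bound, unfolded. [folklore] -/
private theorem bu_order_zero {S : Set ℝ} {c : ℝ → EuclideanSpace ℝ (Fin 3) → F}
    (h : ∃ C : ℝ≥0, ∀ s ∈ S, ∫⁻ x, ‖iteratedFDeriv ℝ 0 (c s) x‖ₑ ^ 2 ≤ C) :
    ∃ C : ℝ≥0, ∀ s ∈ S, ∫⁻ x, ‖c s x‖ₑ ^ 2 ≤ C := by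
  obtain ⟨C, hC⟩ := h
  refine ⟨C, fun s hs => (le_of_eq (lintegral_congr fun x => ?_)).trans (hC s hs)⟩
  rw [← ofReal_norm, ← ofReal_norm, norm_iteratedFDeriv_zero]

omit [MeasurableSpace α] in
/-- Order-one Sobolev bound, as a bound on the Fréchet derivative. [folklore] -/
private theorem bu_order_one {S : Set ℝ} {c : ℝ → EuclideanSpace ℝ (Fin 3) → F}
    (h : ∃ C : ℝ≥0, ∀ s ∈ S, ∫⁻ x, ‖iteratedFDeriv ℝ 1 (c s) x‖ₑ ^ 2 ≤ C) :
    ∃ C : ℝ≥0, ∀ s ∈ S, ∫⁻ x, ‖fderiv ℝ (c s) x‖ₑ ^ 2 ≤ C := by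
  obtain ⟨C, hC⟩ := h
  refine ⟨C, fun s hs => (le_of_eq (lintegral_congr fun x => ?_)).trans (hC s hs)⟩
  have e : ‖fderiv ℝ (c s) x‖ = ‖iteratedFDeriv ℝ 1 (c s) x‖ := by
    rw [← norm_iteratedFDeriv_fderiv, norm_iteratedFDeriv_zero]
  rw [← ofReal_norm, ← ofReal_norm, e]

omit [MeasurableSpace α] in
/-- Uniform-in-time Sobolev bound, at one time: `∫⁻‖Dⁿ(c s)‖² < ∞`. [folklore] -/
private theorem bu_fin {S : Set ℝ} {c : ℝ → EuclideanSpace ℝ (Fin 3) → F}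
    (hB : ∀ n : ℕ, ∃ C : ℝ≥0, ∀ s ∈ S, ∫⁻ x, ‖iteratedFDeriv ℝ n (c s) x‖ₑ ^ 2 ≤ C)
    {s : ℝ} (hs : s ∈ S) (n : ℕ) : ∫⁻ x, ‖iteratedFDeriv ℝ n (c s) x‖ₑ ^ 2 < ⊤ := by
  obtain ⟨C, hC⟩ := hB n
  exact (hC s hs).trans_lt ENNReal.coe_lt_top

omit [MeasurableSpace α] in
/-- Uniform-in-time energy bound, at one time: `∫⁻‖c s‖² < ∞`. [folklore] -/
private theorem bu_fin_zero {S : Set ℝ} {c : ℝ → EuclideanSpace ℝ (Fin 3) → F}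
    (hB : ∀ n : ℕ, ∃ C : ℝ≥0, ∀ s ∈ S, ∫⁻ x, ‖iteratedFDeriv ℝ n (c s) x‖ₑ ^ 2 ≤ C)
    {s : ℝ} (hs : s ∈ S) : ∫⁻ x, ‖c s x‖ₑ ^ 2 < ⊤ := by
  obtain ⟨C, hC⟩ := bu_order_zero (hB 0)
  exact (hC s hs).trans_lt ENNReal.coe_lt_top

omit [MeasurableSpace α] in
/-- A uniform operator-norm bound on `D(c s)` from the Sobolev class (Sobolev embedding,
`exists_enorm_fderiv_le_of_hasBoundedSobolevNormsOn`). [folklore] -/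
private theorem bu_opNorm_fderiv_bound {S : Set ℝ}
    {c : ℝ → EuclideanSpace ℝ (Fin 3) → EuclideanSpace ℝ (Fin 3)}
    (hc : ∀ s ∈ S, ContDiff ℝ ∞ (c s)) (hB : HasBoundedSobolevNormsOn S c) :
    ∃ L : ℝ, 0 ≤ L ∧ ∀ s ∈ S, ∀ x, ‖fderiv ℝ (c s) x‖ ≤ L := by
  obtain ⟨U, hU, h⟩ := exists_enorm_fderiv_le_of_hasBoundedSobolevNormsOn hc hB
  refine ⟨U.toReal, ENNReal.toReal_nonneg, fun s hs x => ?_⟩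
  have h1 := h s hs x
  rw [← ofReal_norm] at h1
  exact (ENNReal.ofReal_le_iff_le_toReal hU.ne).1 h1

end ClassHelpers

/-! ## Slice identities in the `L²` class on `ℝ³` -/

section Slice

/-- **Green's identity in the `L²` class**: for `w ∈ C²(ℝ³)` with `w, Dw, D²w ∈ L²`, the
Frobenius density `|∇w|²_F` is integrable and `∫⟪Δw, w⟫ = −∫ |∇w|²_F` (coordinatewise
integration by parts, `integral_sum_inner_fderiv_fderiv_eq_neg_integral_inner_laplacian`).
[cite: MajdaBertozziCUP2002, §3.1.1 p. 87 (integration by parts for (Δṽ, ṽ))] -/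
theorem integral_inner_laplacian_self_of_l2
    {w : EuclideanSpace ℝ (Fin 3) → EuclideanSpace ℝ (Fin 3)} (hw : ContDiff ℝ 2 w)
    (h0 : ∫⁻ x, ‖w x‖ₑ ^ 2 < ⊤) (h1 : ∫⁻ x, ‖fderiv ℝ w x‖ₑ ^ 2 < ⊤)
    (h2 : ∫⁻ x, ‖iteratedFDeriv ℝ 2 w x‖ₑ ^ 2 < ⊤) :
    Integrable (fun x => FluidPDE.frobeniusNormSq (fderiv ℝ w x)) volume ∧
      ∫ x, ⟪(Δ w) x, w x⟫ = -∫ x, FluidPDE.frobeniusNormSq (fderiv ℝ w x) := by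
  set e := EuclideanSpace.basisFun (Fin 3) ℝ with he
  have he1 : ∀ i, ‖e i‖ = 1 := fun i => by simp [he]
  have hw1 : ContDiff ℝ 1 w := hw.of_le (by norm_num)
  have cw : Continuous w := hw.continuous
  have cDw : Continuous (fderiv ℝ w) := hw.continuous_fderiv (by norm_num)
  have cdiw : ∀ i, Continuous fun x => fderiv ℝ w x (e i) := fun i =>
    cDw.clm_apply continuous_const
  have cddw : ∀ i, Continuous fun x => fderiv ℝ (fun y => fderiv ℝ w y (e i)) x (e i) := fun i =>
    ((((hw.fderiv_right (m := 1) (by norm_num)).clm_apply contDiff_const).continuous_fderiv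
      (by norm_num)).clm_apply continuous_const)
  have l2diw : ∀ i, ∫⁻ x, ‖fderiv ℝ w x (e i)‖ₑ ^ 2 < ⊤ := fun i =>
    lintegral_enorm_sq_lt_top_of_norm_le (fun x => by
      simpa [he1] using (fderiv ℝ w x).le_opNorm (e i)) h1
  have l2ddw : ∀ i, ∫⁻ x, ‖fderiv ℝ (fun y => fderiv ℝ w y (e i)) x (e i)‖ₑ ^ 2 < ⊤ := fun i =>
    lintegral_enorm_sq_lt_top_of_norm_le (fun x => norm_fderiv_fderiv_apply_basisFun_le hw x i) h2
  -- integrability of the Frobenius density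
  have ifrob : Integrable (fun x => FluidPDE.frobeniusNormSq (fderiv ℝ w x)) volume := by
    have hlt : ∫⁻ x, ENNReal.ofReal (FluidPDE.frobeniusNormSq (fderiv ℝ w x)) < ⊤ :=
      calc ∫⁻ x, ENNReal.ofReal (FluidPDE.frobeniusNormSq (fderiv ℝ w x))
          ≤ ∫⁻ x, 3 * ‖fderiv ℝ w x‖ₑ ^ 2 :=
            lintegral_mono fun x => ofReal_frobeniusNormSq_le_three_mul_enorm_sq _
        _ = 3 * ∫⁻ x, ‖fderiv ℝ w x‖ₑ ^ 2 := lintegral_const_mul' _ _ (by norm_num)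
        _ < ⊤ := ENNReal.mul_lt_top (by norm_num) h1
    exact integrable_of_continuous_of_nonneg (FluidPDE.continuous_frobeniusNormSq_fderiv hw (by simp))
      (fun x => FluidPDE.frobeniusNormSq_nonneg _) hlt
  refine ⟨ifrob, ?_⟩
  have i1 : ∀ i, Integrable (fun x => ⟪fderiv ℝ (fun y => fderiv ℝ w y (e i)) x (e i), w x⟫)
      volume := fun i =>
    integrable_of_norm_le_mul_of_lintegral_sq ((cddw i).inner cw).aestronglyMeasurable (cddw i) cw
      (l2ddw i) h0 fun x => norm_inner_le_norm _ _
  have i2 : ∀ i, Integrable (fun x => ⟪fderiv ℝ w x (e i), fderiv ℝ w x (e i)⟫) volume := fun i =>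
    integrable_of_norm_le_mul_of_lintegral_sq ((cdiw i).inner (cdiw i)).aestronglyMeasurable
      (cdiw i) (cdiw i) (l2diw i) (l2diw i) fun x => norm_inner_le_norm _ _
  have i3 : ∀ i, Integrable (fun x => ⟪fderiv ℝ w x (e i), w x⟫) volume := fun i =>
    integrable_of_norm_le_mul_of_lintegral_sq ((cdiw i).inner cw).aestronglyMeasurable (cdiw i) cw
      (l2diw i) h0 fun x => norm_inner_le_norm _ _
  have hG := integral_sum_inner_fderiv_fderiv_eq_neg_integral_inner_laplacian hw hw1 i1 i2 i3
  have hsum : ∫ x, ∑ i, ⟪fderiv ℝ w x (e i), fderiv ℝ w x (e i)⟫ =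
      ∫ x, FluidPDE.frobeniusNormSq (fderiv ℝ w x) := by
    refine integral_congr_ae (Eventually.of_forall fun x => ?_)
    simp only
    rw [FluidPDE.frobeniusNormSq_eq_sum e]
    exact Finset.sum_congr rfl fun i _ => real_inner_self_eq_norm_sq _
  linarith [hG, hsum]

/-- **Young's inequality for the Dirichlet-quotient argument on `ℝ³`**, expanded in `λ`:
for continuous `C ∈ L²` and `w ∈ C²` with `w, Δw ∈ L²`, and `ν > 0`,
`∫⟪C, Δw⟫ + λ∫⟪C, w⟫ ≤ ν (∫‖Δw‖² + 2λ∫⟪Δw, w⟫ + λ²∫‖w‖²) + (4ν)⁻¹ ∫‖C‖²`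
(pointwise `⟪c, y⟫ ≤ ν‖y‖² + ‖c‖²/(4ν)` with `y = Δw + λw`, integrated: the Young step in the
proof of Temam's Lemma III.6.1; whole-space twin of `Torus.integral_inner_laplacian_add_smul_le`).
[cite: Temam1997, Ch. III §6.1 Lemma 6.1, proof, (6.9)–(6.11)] -/
theorem integral_inner_laplacian_add_smul_le_R3
    {C w : EuclideanSpace ℝ (Fin 3) → EuclideanSpace ℝ (Fin 3)} (hC : Continuous C)
    (hw : ContDiff ℝ 2 w) (hC0 : ∫⁻ x, ‖C x‖ₑ ^ 2 < ⊤) (hw0 : ∫⁻ x, ‖w x‖ₑ ^ 2 < ⊤)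
    (hΔ0 : ∫⁻ x, ‖(Δ w) x‖ₑ ^ 2 < ⊤) {ν : ℝ} (hν : 0 < ν) (l : ℝ) :
    (∫ x, ⟪C x, (Δ w) x⟫) + l * ∫ x, ⟪C x, w x⟫ ≤
      ν * ((∫ x, ‖(Δ w) x‖ ^ 2) + 2 * l * (∫ x, ⟪(Δ w) x, w x⟫) + l ^ 2 * ∫ x, ‖w x‖ ^ 2) +
        (4 * ν)⁻¹ * ∫ x, ‖C x‖ ^ 2 := by
  have cΔ : Continuous (Δ w) := continuous_laplacian hw
  have cw : Continuous w := hw.continuous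
  have iCΔ : Integrable (fun x => ⟪C x, (Δ w) x⟫) volume :=
    integrable_of_norm_le_mul_of_lintegral_sq (hC.inner cΔ).aestronglyMeasurable hC cΔ hC0 hΔ0
      fun x => norm_inner_le_norm _ _
  have iCw : Integrable (fun x => ⟪C x, w x⟫) volume :=
    integrable_of_norm_le_mul_of_lintegral_sq (hC.inner cw).aestronglyMeasurable hC cw hC0 hw0
      fun x => norm_inner_le_norm _ _
  have iΔw : Integrable (fun x => ⟪(Δ w) x, w x⟫) volume :=
    integrable_of_norm_le_mul_of_lintegral_sq (cΔ.inner cw).aestronglyMeasurable cΔ cw hΔ0 hw0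
      fun x => norm_inner_le_norm _ _
  have iΔΔ : Integrable (fun x => ‖(Δ w) x‖ ^ 2) volume := integrable_sq_norm_of_lintegral_lt_top cΔ hΔ0
  have iww : Integrable (fun x => ‖w x‖ ^ 2) volume := integrable_sq_norm_of_lintegral_lt_top cw hw0
  have iCC : Integrable (fun x => ‖C x‖ ^ 2) volume := integrable_sq_norm_of_lintegral_lt_top hC hC0
  -- pointwise Young, expanded
  have hpt : ∀ x, ⟪C x, (Δ w) x⟫ + l * ⟪C x, w x⟫ ≤
      ν * (‖(Δ w) x‖ ^ 2 + 2 * l * ⟪(Δ w) x, w x⟫ + l ^ 2 * ‖w x‖ ^ 2) +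
        (4 * ν)⁻¹ * ‖C x‖ ^ 2 := by
    intro x
    set y := (Δ w) x + l • w x with hy
    have e1 : ⟪C x, (Δ w) x⟫ + l * ⟪C x, w x⟫ = ⟪C x, y⟫ := by
      rw [hy, inner_add_right, real_inner_smul_right]
    have e2 : ‖(Δ w) x‖ ^ 2 + 2 * l * ⟪(Δ w) x, w x⟫ + l ^ 2 * ‖w x‖ ^ 2 = ‖y‖ ^ 2 := by
      rw [hy, norm_add_sq_real, real_inner_smul_right, norm_smul, mul_pow, Real.norm_eq_abs,
        sq_abs]
      ring
    rw [e1, e2]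
    have h1 : ⟪C x, y⟫ ≤ ‖C x‖ * ‖y‖ := real_inner_le_norm _ _
    have h2 : 4 * ν * (‖C x‖ * ‖y‖) ≤ 4 * ν * (ν * ‖y‖ ^ 2) + ‖C x‖ ^ 2 := by
      nlinarith [sq_nonneg (2 * ν * ‖y‖ - ‖C x‖), norm_nonneg (C x), norm_nonneg y]
    have h3 : ‖C x‖ * ‖y‖ ≤ ν * ‖y‖ ^ 2 + (4 * ν)⁻¹ * ‖C x‖ ^ 2 := by
      rw [← sub_nonneg]
      have e : ν * ‖y‖ ^ 2 + (4 * ν)⁻¹ * ‖C x‖ ^ 2 - ‖C x‖ * ‖y‖ =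
          (4 * ν)⁻¹ * (4 * ν * (ν * ‖y‖ ^ 2) + ‖C x‖ ^ 2 - 4 * ν * (‖C x‖ * ‖y‖)) := by
        field_simp
      rw [e]
      exact mul_nonneg (by positivity) (by linarith)
    exact h1.trans h3
  have hiL : Integrable (fun x => ⟪C x, (Δ w) x⟫ + l * ⟪C x, w x⟫) volume :=
    iCΔ.add (iCw.const_mul l)
  have i12 : Integrable (fun x => ‖(Δ w) x‖ ^ 2 + 2 * l * ⟪(Δ w) x, w x⟫) volume :=
    iΔΔ.add (iΔw.const_mul _)
  have i123 : Integrable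
      (fun x => ‖(Δ w) x‖ ^ 2 + 2 * l * ⟪(Δ w) x, w x⟫ + l ^ 2 * ‖w x‖ ^ 2) volume :=
    i12.add (iww.const_mul _)
  have hiR : Integrable (fun x => ν * (‖(Δ w) x‖ ^ 2 + 2 * l * ⟪(Δ w) x, w x⟫ +
      l ^ 2 * ‖w x‖ ^ 2) + (4 * ν)⁻¹ * ‖C x‖ ^ 2) volume :=
    (i123.const_mul ν).add (iCC.const_mul _)
  have hint := integral_mono hiL hiR hpt
  have hl : ∫ x, (⟪C x, (Δ w) x⟫ + l * ⟪C x, w x⟫) =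
      (∫ x, ⟪C x, (Δ w) x⟫) + l * ∫ x, ⟪C x, w x⟫ := by
    rw [integral_add iCΔ (iCw.const_mul l), integral_const_mul]
  have hr : ∫ x, (ν * (‖(Δ w) x‖ ^ 2 + 2 * l * ⟪(Δ w) x, w x⟫ + l ^ 2 * ‖w x‖ ^ 2) +
        (4 * ν)⁻¹ * ‖C x‖ ^ 2) =
      ν * ((∫ x, ‖(Δ w) x‖ ^ 2) + 2 * l * (∫ x, ⟪(Δ w) x, w x⟫) + l ^ 2 * ∫ x, ‖w x‖ ^ 2) +
        (4 * ν)⁻¹ * ∫ x, ‖C x‖ ^ 2 := by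
    rw [integral_add (i123.const_mul ν) (iCC.const_mul _), integral_const_mul, integral_const_mul,
      integral_add i12 (iww.const_mul _), integral_add iΔΔ (iΔw.const_mul _), integral_const_mul,
      integral_const_mul]
  rw [hl, hr] at hint
  exact hint

end Slice

/-! ## Backward uniqueness on `ℝ³` in the classical `L²`-Sobolev class -/

section Main
set_option maxHeartbeats 400000 in -- buildfix (bf3-g27): 160k/180k FAIL, 200k PASS at accept time; line-neutral budget line
/-- **Backward uniqueness for the Navier–Stokes equations on `ℝ³` in the smooth finite-energy
class** (Tao's class: classical solutions with all `L²`-Sobolev norms of the velocity and of its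
time derivative bounded on `[0, T]`, and `L²`-Sobolev pressures): two such solutions with the same
viscosity `ν > 0` and zero force which agree at the final time `T` agree on `[0, T]`.
Proof (log-convexity / Dirichlet quotient, Temam 1997 Ch. III §6, Constantin–Foias Thm 12.2): for
`w = v − u`, `E = ∫‖w‖²` and `X = ∫|∇w|²_F` satisfy `E' = −2νX − 2∫⟪(w·∇)u, w⟫ ≥ −(2νX + 2LE)`
(`L = sup‖∇u‖`, the `L²` balance `IsSmoothSpaceTimeOn.l2_balance` with the slice identity
`l2_slice_strain_identity`) and `X' = −2ν∫‖Δw‖² + 2∫⟪(v·∇)w + (w·∇)u, Δw⟫`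
(`IsClassicalNSSolutionOn.enstrophy_sub_balance_forces`), whence the Dirichlet-quotient law
`X'E − XE' ≤ K(X + E)E`, `K = (M² + L²)/ν` (`M = sup‖v‖`; Young's inequality and
`∫⟪(v·∇)w, w⟫ = 0`), and `E(T) = 0` forces `E ≡ 0`
(`Literature.Analysis.ODE.eq_zero_of_dirichletQuotient_law`). All time derivatives are one-sided
within `[0, T]` and hold at the endpoints (balance + continuity of the fluxes in `C([0,T]; L²)`).
[cite: Temam1997, Ch. III §6.1 Lemma 6.2 and §6.2 (6.16)–(6.17); ConstantinFoiasNSE1988, Ch. 12 Thm 12.2] -/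
theorem IsClassicalNSSolutionOn.velocity_backward_unique_R3 {ν T : ℝ}
    {u v : ℝ → EuclideanSpace ℝ (Fin 3) → EuclideanSpace ℝ (Fin 3)}
    {p q : ℝ → EuclideanSpace ℝ (Fin 3) → ℝ} (hν : 0 < ν) (hT : 0 < T)
    (hv : IsClassicalNSSolutionOn (Icc 0 T) ν 0 v q)
    (hu : IsClassicalNSSolutionOn (Icc 0 T) ν 0 u p)
    (hU : HasBoundedSobolevNormsOn (Icc 0 T) u)
    (hUt : HasBoundedSobolevNormsOn (Icc 0 T) (FluidPDE.timeDerivWithin (Icc 0 T) u))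
    (hp : ∀ n : ℕ, ∃ C : ℝ≥0, ∀ t ∈ Icc 0 T, ∫⁻ x, ‖iteratedFDeriv ℝ n (p t) x‖ₑ ^ 2 ≤ C)
    (hV : HasBoundedSobolevNormsOn (Icc 0 T) v)
    (hVt : HasBoundedSobolevNormsOn (Icc 0 T) (FluidPDE.timeDerivWithin (Icc 0 T) v))
    (hq : ∀ n : ℕ, ∃ C : ℝ≥0, ∀ t ∈ Icc 0 T, ∫⁻ x, ‖iteratedFDeriv ℝ n (q t) x‖ₑ ^ 2 ≤ C)
    (hfin : v T = u T) : ∀ t ∈ Icc 0 T, v t = u t := by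
  intro t ht
  have hS : UniqueDiffOn ℝ (Icc 0 T) := uniqueDiffOn_Icc hT
  have hcl : Icc 0 T ⊆ closure (interior (Icc 0 T)) := by
    rw [interior_Icc, closure_Ioo hT.ne]
  have h0T : (0 : ℝ) ∈ Icc 0 T := ⟨le_rfl, hT.le⟩
  -- the enstrophy balance of the difference (zero forces), then name the difference
  obtain ⟨-, hXc, hXbal⟩ := hv.enstrophy_sub_balance_forces hT hu hU hUt hp hV hVt hq
  set w : ℝ → EuclideanSpace ℝ (Fin 3) → EuclideanSpace ℝ (Fin 3) := v - u with hw_def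
  have hwx : ∀ s x, w s x = v s x - u s x := fun _ _ => rfl
  have hvsm : IsSmoothSpaceTimeOn (Icc 0 T) v := hv.smooth_velocity
  have husm : IsSmoothSpaceTimeOn (Icc 0 T) u := hu.smooth_velocity
  have hwsm : IsSmoothSpaceTimeOn (Icc 0 T) w := hvsm.sub husm
  have hWt : ∀ s ∈ Icc 0 T, ∀ x, FluidPDE.timeDerivWithin (Icc 0 T) w s x =
      FluidPDE.timeDerivWithin (Icc 0 T) v s x - FluidPDE.timeDerivWithin (Icc 0 T) u s x :=
    fun s hs x => hvsm.timeDerivWithin_sub husm hs x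
  -- smooth slices
  have cd_v : ∀ s ∈ Icc 0 T, ContDiff ℝ ∞ (v s) := fun s hs => hv.contDiff_velocity hs
  have cd_u : ∀ s ∈ Icc 0 T, ContDiff ℝ ∞ (u s) := fun s hs => hu.contDiff_velocity hs
  have cd_w : ∀ s ∈ Icc 0 T, ContDiff ℝ ∞ (w s) := fun s hs => hwsm.contDiff_slice hs
  have cd_vt : ∀ s ∈ Icc 0 T, ContDiff ℝ ∞ (FluidPDE.timeDerivWithin (Icc 0 T) v s) :=
    fun s hs => (hvsm.timeDerivWithin hS).contDiff_slice hs
  have cd_ut : ∀ s ∈ Icc 0 T, ContDiff ℝ ∞ (FluidPDE.timeDerivWithin (Icc 0 T) u s) :=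
    fun s hs => (husm.timeDerivWithin hS).contDiff_slice hs
  have cd_wt : ∀ s ∈ Icc 0 T, ContDiff ℝ ∞ (FluidPDE.timeDerivWithin (Icc 0 T) w s) :=
    fun s hs => (hwsm.timeDerivWithin hS).contDiff_slice hs
  -- Sobolev bounds of `w` and `∂ₜw`
  have hwsob : ∀ n : ℕ, ∃ C : ℝ≥0, ∀ s ∈ Icc 0 T,
      ∫⁻ x, ‖iteratedFDeriv ℝ n (w s) x‖ₑ ^ 2 ≤ C :=
    bu_sobolev_sub (c := w) (fun s _ x => hwx s x) cd_v cd_u hV hU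
  have hwtsob : ∀ n : ℕ, ∃ C : ℝ≥0, ∀ s ∈ Icc 0 T,
      ∫⁻ x, ‖iteratedFDeriv ℝ n (FluidPDE.timeDerivWithin (Icc 0 T) w s) x‖ₑ ^ 2 ≤ C :=
    bu_sobolev_sub (c := FluidPDE.timeDerivWithin (Icc 0 T) w) hWt cd_vt cd_ut hVt hUt
  obtain ⟨C₀, hC₀⟩ := bu_order_zero (hwsob 0)
  obtain ⟨C₁, hC₁⟩ := bu_order_one (hwsob 1)
  obtain ⟨C₂, hC₂⟩ := hwsob 2
  obtain ⟨D₀, hD₀⟩ := bu_order_zero (hwtsob 0)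
  obtain ⟨D₁, hD₁⟩ := bu_order_one (hwtsob 1)
  obtain ⟨D₂, hD₂⟩ := hwtsob 2
  -- sup bounds: `‖v‖ ≤ M`, `‖∂ₜv‖ ≤ M'`, `‖u‖ ≤ Mᵤ`, `‖Du‖ ≤ L`, `‖D∂ₜu‖ ≤ L'`
  obtain ⟨M, hM⟩ := linfty_bound_of_hasBoundedSobolevNormsOn_holds
    (fun s hs => (cd_v s hs).of_le (by norm_cast)) hV
  obtain ⟨M', hM'⟩ := linfty_bound_of_hasBoundedSobolevNormsOn_holds
    (fun s hs => (cd_vt s hs).of_le (by norm_cast)) hVt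
  obtain ⟨Mu, hMu⟩ := linfty_bound_of_hasBoundedSobolevNormsOn_holds
    (fun s hs => (cd_u s hs).of_le (by norm_cast)) hU
  obtain ⟨L, hL0, hL⟩ := bu_opNorm_fderiv_bound cd_u hU
  obtain ⟨L', hL'0, hL'⟩ := bu_opNorm_fderiv_bound cd_ut hUt
  have hM0 : 0 ≤ M := (norm_nonneg _).trans (hM 0 h0T 0)
  have hM'0 : 0 ≤ M' := (norm_nonneg _).trans (hM' 0 h0T 0)
  -- pointwise bounds on the convective slices
  have nS : ∀ s ∈ Icc 0 T, ∀ y, ‖FluidPDE.convect (w s) (u s) y‖ ≤ L * ‖w s y‖ := by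
    intro s hs y
    simp only [FluidPDE.convect]
    exact ((fderiv ℝ (u s) y).le_opNorm _).trans
      (mul_le_mul_of_nonneg_right (hL s hs y) (norm_nonneg _))
  have nN₁ : ∀ s ∈ Icc 0 T, ∀ y, ‖FluidPDE.convect (v s) (w s) y‖ ≤ M * ‖fderiv ℝ (w s) y‖ := by
    intro s hs y
    simp only [FluidPDE.convect]
    rw [mul_comm]
    exact (fderiv ℝ (w s) y).le_opNorm_of_le (hM s hs y)
  -- (F1) `w ∈ C([0,T]; L²)`
  have hcw : ContinuousInLpOn (Icc 0 T) 2 w := hwsm.continuousInLpOn_two hT hC₀ hD₀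
  -- (F2) `Δw ∈ C([0,T]; L²)`
  have hΔsm : IsSmoothSpaceTimeOn (Icc 0 T) (fun s y => (Δ (w s)) y) := hwsm.laplacian hS
  have hΔb : ∀ s ∈ Icc 0 T, ∫⁻ y, ‖(Δ (w s)) y‖ₑ ^ 2 ≤ ((((3 : ℝ) ^ 2).toNNReal * C₂ : ℝ≥0)) :=
    fun s hs => lintegral_enorm_sq_le_coe_of_norm_le_mul
      (fun y => norm_laplacian_le_three_mul_norm_iteratedFDeriv_two
        ((cd_w s hs).of_le (by norm_cast)) y) (hC₂ s hs)
  have hΔtb : ∀ s ∈ Icc 0 T,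
      ∫⁻ y, ‖FluidPDE.timeDerivWithin (Icc 0 T) (fun s y => (Δ (w s)) y) s y‖ₑ ^ 2 ≤
        ((((3 : ℝ) ^ 2).toNNReal * D₂ : ℝ≥0)) := by
    intro s hs
    have e : ∀ y, FluidPDE.timeDerivWithin (Icc 0 T) (fun s y => (Δ (w s)) y) s y =
        (Δ (FluidPDE.timeDerivWithin (Icc 0 T) w s)) y :=
      fun y => hwsm.timeDerivWithin_laplacian hS hcl hs y
    have h2 : ∫⁻ y, ‖(Δ (FluidPDE.timeDerivWithin (Icc 0 T) w s)) y‖ₑ ^ 2 ≤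
        ((((3 : ℝ) ^ 2).toNNReal * D₂ : ℝ≥0)) :=
      lintegral_enorm_sq_le_coe_of_norm_le_mul
        (fun y => norm_laplacian_le_three_mul_norm_iteratedFDeriv_two
          ((cd_wt s hs).of_le (by norm_cast)) y) (hD₂ s hs)
    calc ∫⁻ y, ‖FluidPDE.timeDerivWithin (Icc 0 T) (fun s y => (Δ (w s)) y) s y‖ₑ ^ 2
        = ∫⁻ y, ‖(Δ (FluidPDE.timeDerivWithin (Icc 0 T) w s)) y‖ₑ ^ 2 :=
          lintegral_congr fun y => by rw [e]
      _ ≤ _ := h2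
  have hcΔ : ContinuousInLpOn (Icc 0 T) 2 (fun s y => (Δ (w s)) y) :=
    hΔsm.continuousInLpOn_two hT hΔb hΔtb
  -- (F3) `(w·∇)u ∈ C([0,T]; L²)`
  have hSsm : IsSmoothSpaceTimeOn (Icc 0 T) (fun s y => FluidPDE.convect (w s) (u s) y) :=
    hwsm.convect husm hS
  have hSb : ∀ s ∈ Icc 0 T,
      ∫⁻ y, ‖FluidPDE.convect (w s) (u s) y‖ₑ ^ 2 ≤ (((L ^ 2).toNNReal * C₀ : ℝ≥0)) :=
    fun s hs => lintegral_enorm_sq_le_coe_of_norm_le_mul (nS s hs) (hC₀ s hs)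
  have hStb : ∀ s ∈ Icc 0 T,
      ∫⁻ y, ‖FluidPDE.timeDerivWithin (Icc 0 T) (fun s y => FluidPDE.convect (w s) (u s) y) s y‖ₑ ^ 2
        ≤ ((2 * (L' ^ 2).toNNReal * C₀ + 2 * (L ^ 2).toNNReal * D₀ : ℝ≥0)) := by
    intro s hs
    have e : ∀ y, FluidPDE.timeDerivWithin (Icc 0 T) (fun s y => FluidPDE.convect (w s) (u s) y) s y
        = FluidPDE.convect (w s) (FluidPDE.timeDerivWithin (Icc 0 T) u s) y +
          FluidPDE.convect (FluidPDE.timeDerivWithin (Icc 0 T) w s) (u s) y :=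
      fun y => hwsm.timeDerivWithin_convect husm hS hcl hs y
    have hle : ∀ y,
        ‖FluidPDE.timeDerivWithin (Icc 0 T) (fun s y => FluidPDE.convect (w s) (u s) y) s y‖ ≤
          L' * ‖w s y‖ + L * ‖FluidPDE.timeDerivWithin (Icc 0 T) w s y‖ := by
      intro y
      rw [e]
      refine (norm_add_le _ _).trans (add_le_add ?_ ?_)
      · simp only [FluidPDE.convect]
        exact ((fderiv ℝ (FluidPDE.timeDerivWithin (Icc 0 T) u s) y).le_opNorm _).trans
          (mul_le_mul_of_nonneg_right (hL' s hs y) (norm_nonneg _))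
      · simp only [FluidPDE.convect]
        exact ((fderiv ℝ (u s) y).le_opNorm _).trans
          (mul_le_mul_of_nonneg_right (hL s hs y) (norm_nonneg _))
    exact lintegral_enorm_sq_le_coe_of_norm_le_two hL'0 hL0 hle
      (cd_w s hs).continuous.aestronglyMeasurable (hC₀ s hs) (hD₀ s hs)
  have hcS : ContinuousInLpOn (Icc 0 T) 2 (fun s y => FluidPDE.convect (w s) (u s) y) :=
    hSsm.continuousInLpOn_two hT hSb hStb
  -- (F4) `(v·∇)w ∈ C([0,T]; L²)`
  have hN₁sm : IsSmoothSpaceTimeOn (Icc 0 T) (fun s y => FluidPDE.convect (v s) (w s) y) :=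
    hvsm.convect hwsm hS
  have hN₁b : ∀ s ∈ Icc 0 T,
      ∫⁻ y, ‖FluidPDE.convect (v s) (w s) y‖ₑ ^ 2 ≤ (((M ^ 2).toNNReal * C₁ : ℝ≥0)) :=
    fun s hs => lintegral_enorm_sq_le_coe_of_norm_le_mul (nN₁ s hs) (hC₁ s hs)
  have hN₁tb : ∀ s ∈ Icc 0 T,
      ∫⁻ y, ‖FluidPDE.timeDerivWithin (Icc 0 T) (fun s y => FluidPDE.convect (v s) (w s) y) s y‖ₑ ^ 2
        ≤ ((2 * (M ^ 2).toNNReal * D₁ + 2 * (M' ^ 2).toNNReal * C₁ : ℝ≥0)) := by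
    intro s hs
    have e : ∀ y, FluidPDE.timeDerivWithin (Icc 0 T) (fun s y => FluidPDE.convect (v s) (w s) y) s y
        = FluidPDE.convect (v s) (FluidPDE.timeDerivWithin (Icc 0 T) w s) y +
          FluidPDE.convect (FluidPDE.timeDerivWithin (Icc 0 T) v s) (w s) y :=
      fun y => hvsm.timeDerivWithin_convect hwsm hS hcl hs y
    have hle : ∀ y,
        ‖FluidPDE.timeDerivWithin (Icc 0 T) (fun s y => FluidPDE.convect (v s) (w s) y) s y‖ ≤
          M * ‖fderiv ℝ (FluidPDE.timeDerivWithin (Icc 0 T) w s) y‖ + M' * ‖fderiv ℝ (w s) y‖ := by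
      intro y
      rw [e]
      refine (norm_add_le _ _).trans (add_le_add ?_ ?_)
      · simp only [FluidPDE.convect]
        rw [mul_comm]
        exact (fderiv ℝ (FluidPDE.timeDerivWithin (Icc 0 T) w s) y).le_opNorm_of_le (hM s hs y)
      · simp only [FluidPDE.convect]
        rw [mul_comm]
        exact (fderiv ℝ (w s) y).le_opNorm_of_le (hM' s hs y)
    exact lintegral_enorm_sq_le_coe_of_norm_le_two hM0 hM'0 hle
      ((cd_wt s hs).continuous_fderiv (by simp)).aestronglyMeasurable (hD₁ s hs) (hC₁ s hs)
  have hcN₁ : ContinuousInLpOn (Icc 0 T) 2 (fun s y => FluidPDE.convect (v s) (w s) y) :=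
    hN₁sm.continuousInLpOn_two hT hN₁b hN₁tb
  have hcN : ContinuousInLpOn (Icc 0 T) 2
      (fun s y => FluidPDE.convect (v s) (w s) y + FluidPDE.convect (w s) (u s) y) :=
    hcN₁.add (by norm_num) hcS
  -- the functions of time
  set E : ℝ → ℝ := fun s => ∫ x, ‖w s x‖ ^ 2 with hE_def
  set X : ℝ → ℝ := fun s => ∫ x, FluidPDE.frobeniusNormSq (fderiv ℝ (w s) x) with hX_def
  set R : ℝ → ℝ := fun s => ∫ x, ⟪FluidPDE.convect (w s) (u s) x, w s x⟫ with hR_def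
  set D : ℝ → ℝ := fun s => ∫ x, ‖(Δ (w s)) x‖ ^ 2 with hD_def
  set P : ℝ → ℝ := fun s => ∫ x, ⟪FluidPDE.convect (v s) (w s) x + FluidPDE.convect (w s) (u s) x,
    (Δ (w s)) x⟫ with hP_def
  set E' : ℝ → ℝ := fun s => -(2 * ν * X s) - 2 * R s with hE'_def
  set V' : ℝ → ℝ := fun s => -(2 * ν * D s) + 2 * P s with hV'_def
  set K : ℝ := (M ^ 2 + L ^ 2) / ν with hK_def
  have hK0 : 0 ≤ K := by positivity
  -- continuity of the fluxes
  have hEc : ContinuousOn E (Icc 0 T) := hcw.continuousOn_integral_norm_sq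
  have hDc : ContinuousOn D (Icc 0 T) := hcΔ.continuousOn_integral_norm_sq
  have hRc : ContinuousOn R (Icc 0 T) := hcS.continuousOn_integral_inner_pair hcw
  have hPc : ContinuousOn P (Icc 0 T) := hcN.continuousOn_integral_inner_pair hcΔ
  have hE'c : ContinuousOn E' (Icc 0 T) :=
    ((continuousOn_const.mul hXc).neg).sub (continuousOn_const.mul hRc)
  have hV'c : ContinuousOn V' (Icc 0 T) :=
    ((continuousOn_const.mul hDc).neg).add (continuousOn_const.mul hPc)
  -- the energy flux: `∫ 2⟪w, ∂ₜw⟫ = -2νX - 2R` at every time (slice identity, forces zero)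
  have hflux : ∀ s ∈ Icc 0 T,
      (∫ x, 2 * ⟪w s x, FluidPDE.timeDerivWithin (Icc 0 T) w s x⟫) = E' s := by
    intro s hs
    have hmom₁ : ∀ x, FluidPDE.timeDerivWithin (Icc 0 T) v s x + FluidPDE.convect (v s) (v s) x =
        ν • (Δ (v s)) x - gradient (q s) x := by
      intro x
      have h := hv.momentum s hs x
      simpa only [Pi.zero_apply, add_zero] using h
    have hmom₂ : ∀ x, FluidPDE.timeDerivWithin (Icc 0 T) u s x + FluidPDE.convect (u s) (u s) x =
        ν • (Δ (u s)) x - gradient (p s) x := by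
      intro x
      have h := hu.momentum s hs x
      simpa only [Pi.zero_apply, add_zero] using h
    have key := l2_slice_strain_identity ((cd_v s hs).of_le (by norm_cast))
      ((cd_u s hs).of_le (by norm_cast)) ((cd_vt s hs).of_le (by norm_cast))
      ((cd_ut s hs).of_le (by norm_cast)) ((hv.contDiff_pressure hs).of_le (by norm_cast))
      ((hu.contDiff_pressure hs).of_le (by norm_cast)) hmom₁ hmom₂ (hv.divFree s hs)
      (hu.divFree s hs) (B := max M Mu) (fun x => (hM s hs x).trans (le_max_left _ _))
      (fun x => (hMu s hs x).trans (le_max_right _ _))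
      (bu_fin_zero hV hs) (bu_fin hV hs 1) (bu_fin hV hs 2)
      (bu_fin_zero hU hs) (bu_fin hU hs 1) (bu_fin hU hs 2)
      (bu_fin_zero hVt hs) (bu_fin_zero hUt hs)
      (bu_fin_zero hq hs) (bu_fin hq hs 1) (bu_fin_zero hp hs) (bu_fin hp hs 1)
    have h1 : (∫ x, 2 * ⟪w s x, FluidPDE.timeDerivWithin (Icc 0 T) w s x⟫) =
        2 * ∫ x, ⟪v s x - u s x,
          FluidPDE.timeDerivWithin (Icc 0 T) v s x - FluidPDE.timeDerivWithin (Icc 0 T) u s x⟫ := by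
      rw [integral_const_mul]
      congr 1
      refine integral_congr_ae (Eventually.of_forall fun x => ?_)
      simp only [hwx, hWt s hs x]
    have h2 : (∫ x, ⟪v s x - u s x, fderiv ℝ (u s) x (v s x - u s x)⟫) = R s := by
      simp only [hR_def]
      refine integral_congr_ae (Eventually.of_forall fun x => ?_)
      simp only [FluidPDE.convect, hwx]
      exact real_inner_comm _ _
    have h3 : (∫ x, FluidPDE.frobeniusNormSq (fderiv ℝ (fun y => v s y - u s y) x)) = X s := rfl
    rw [h1, key, h2, h3]
  -- the energy balance on `[0, T]`
  obtain ⟨-, -, hEbal⟩ := hwsm.l2_balance hT hC₀ hD₀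
  have hEbal' : ∀ b ∈ Icc 0 T, E b = E 0 + ∫ τ in (0 : ℝ)..b, E' τ := by
    intro b hb
    rcases eq_or_lt_of_le hb.1 with h0 | h0
    · subst h0
      rw [intervalIntegral.integral_same, add_zero]
    · have h := hEbal b ⟨h0, hb.2⟩
      simp only [hE_def]
      rw [h]
      congr 1
      refine intervalIntegral.integral_congr fun τ hτ => ?_
      rw [uIcc_of_le hb.1] at hτ
      exact hflux τ ⟨hτ.1, hτ.2.trans hb.2⟩
  -- the enstrophy balance on `[0, T]` (forces zero)
  have hXbal' : ∀ b ∈ Icc 0 T, X b = X 0 + ∫ τ in (0 : ℝ)..b, V' τ := by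
    intro b hb
    have h := hXbal b hb
    simp only [Pi.zero_apply, sub_self, inner_zero_left, integral_zero, mul_zero, add_zero] at h
    simpa only [hX_def, hV'_def, hD_def, hP_def] using h
  -- derivatives within `[0, T]`, at every point
  have hEd : ∀ s ∈ Icc 0 T, HasDerivWithinAt E (E' s) (Icc 0 T) s := fun s hs =>
    hasDerivWithinAt_Icc_of_eq_add_intervalIntegral hE'c hEbal' hs
  have hXd : ∀ s ∈ Icc 0 T, HasDerivWithinAt X (V' s) (Icc 0 T) s := fun s hs =>
    hasDerivWithinAt_Icc_of_eq_add_intervalIntegral hV'c hXbal' hs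
  have hE0 : ∀ s ∈ Icc 0 T, 0 ≤ E s := fun s _ => integral_nonneg fun x => sq_nonneg _
  have hX0 : ∀ s ∈ Icc 0 T, 0 ≤ X s := fun s _ =>
    integral_nonneg fun x => FluidPDE.frobeniusNormSq_nonneg _
  -- the energy inequality `E' ≥ -(2νX + 2LE)`
  have hlow : ∀ s ∈ Icc 0 T, 0 < E s → -(2 * ν * X s + 2 * L * E s) ≤ E' s := by
    intro s hs _
    have cw : Continuous (w s) := (cd_w s hs).continuous
    have l2w : ∫⁻ x, ‖w s x‖ₑ ^ 2 < ⊤ := (hC₀ s hs).trans_lt ENNReal.coe_lt_top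
    have iww : Integrable (fun x => ‖w s x‖ ^ 2) volume :=
      integrable_sq_norm_of_lintegral_lt_top cw l2w
    have hRle : |R s| ≤ L * E s := by
      simp only [hR_def, hE_def]
      rw [← Real.norm_eq_abs, ← integral_const_mul]
      refine norm_integral_le_of_norm_le (iww.const_mul L) (Eventually.of_forall fun x => ?_)
      calc ‖⟪FluidPDE.convect (w s) (u s) x, w s x⟫‖
          ≤ ‖FluidPDE.convect (w s) (u s) x‖ * ‖w s x‖ := norm_inner_le_norm _ _
        _ ≤ (L * ‖w s x‖) * ‖w s x‖ :=
            mul_le_mul_of_nonneg_right (nS s hs x) (norm_nonneg _)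
        _ = L * ‖w s x‖ ^ 2 := by ring
    have hR' := (abs_le.1 hRle).2
    simp only [hE'_def]
    linarith
  -- the Dirichlet-quotient law `X'E - XE' ≤ K(X + E)E`
  have hquot : ∀ s ∈ Icc 0 T, 0 < E s → V' s * E s - X s * E' s ≤ K * (X s + E s) * E s := by
    intro s hs hEs
    have hw2 : ContDiff ℝ 2 (w s) := (cd_w s hs).of_le (by norm_cast)
    have hw1 : ContDiff ℝ 1 (w s) := (cd_w s hs).of_le (by norm_cast)
    have cw : Continuous (w s) := hw1.continuous
    have cv : Continuous (v s) := (cd_v s hs).continuous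
    have cDw : Continuous (fderiv ℝ (w s)) := hw1.continuous_fderiv one_ne_zero
    have cN₁ : Continuous fun x => FluidPDE.convect (v s) (w s) x := by
      simp only [FluidPDE.convect]; exact cDw.clm_apply cv
    have cSx : Continuous fun x => FluidPDE.convect (w s) (u s) x := by
      simp only [FluidPDE.convect]
      exact ((cd_u s hs).continuous_fderiv (by simp)).clm_apply cw
    have cN : Continuous fun x => FluidPDE.convect (v s) (w s) x + FluidPDE.convect (w s) (u s) x :=
      cN₁.add cSx
    have l2w : ∫⁻ x, ‖w s x‖ₑ ^ 2 < ⊤ := (hC₀ s hs).trans_lt ENNReal.coe_lt_top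
    have l2Dw : ∫⁻ x, ‖fderiv ℝ (w s) x‖ₑ ^ 2 < ⊤ := (hC₁ s hs).trans_lt ENNReal.coe_lt_top
    have l2D2w : ∫⁻ x, ‖iteratedFDeriv ℝ 2 (w s) x‖ₑ ^ 2 < ⊤ :=
      (hC₂ s hs).trans_lt ENNReal.coe_lt_top
    have l2Δ : ∫⁻ x, ‖(Δ (w s)) x‖ₑ ^ 2 < ⊤ := (hΔb s hs).trans_lt ENNReal.coe_lt_top
    have l2N₁ : ∫⁻ x, ‖FluidPDE.convect (v s) (w s) x‖ₑ ^ 2 < ⊤ :=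
      (hN₁b s hs).trans_lt ENNReal.coe_lt_top
    have l2S : ∫⁻ x, ‖FluidPDE.convect (w s) (u s) x‖ₑ ^ 2 < ⊤ :=
      (hSb s hs).trans_lt ENNReal.coe_lt_top
    have l2N : ∫⁻ x, ‖FluidPDE.convect (v s) (w s) x + FluidPDE.convect (w s) (u s) x‖ₑ ^ 2 < ⊤ :=
      lintegral_enorm_sq_lt_top_of_norm_le_add (fun x => norm_add_le _ _) cN₁.aestronglyMeasurable
        l2N₁ l2S
    -- Green: `∫⟪Δw, w⟫ = -X s`, and `|∇w|²_F ∈ L¹`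
    obtain ⟨ifrob, hJ⟩ := integral_inner_laplacian_self_of_l2 hw2 l2w l2Dw l2D2w
    -- transport: `∫⟪(v·∇)w, w⟫ = 0`
    have hwm : MemLp (w s) 2 volume :=
      ⟨cw.aestronglyMeasurable, eLpNorm_two_lt_top_of_lintegral_enorm_sq_lt_top l2w⟩
    have htrans : ∫ x, ⟪FluidPDE.convect (v s) (w s) x, w s x⟫ = 0 := by
      have hwd : IsWeaklyDivFree (v s) :=
        VectorCalculus.IsDivFree.isWeaklyDivFree_holds (hv.divFree s hs)
          ((cd_v s hs).of_le (by norm_cast))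
      have hwg : HasWeakGradient (w s) (fderiv ℝ (w s)) := hasWeakGradient_fderiv_of_contDiff hw1
      have hG2 : ∫⁻ x, ENNReal.ofReal (FluidPDE.frobeniusNormSq (fderiv ℝ (w s) x)) < ⊤ := by
        rw [← ofReal_integral_eq_lintegral_ofReal ifrob
          (Eventually.of_forall fun x => FluidPDE.frobeniusNormSq_nonneg _)]
        exact ENNReal.ofReal_lt_top
      have hvtop : MemLp (v s) ⊤ volume :=
        memLp_top_of_bound cv.aestronglyMeasurable M (Eventually.of_forall (hM s hs))
      have h := integral_inner_weakGrad_apply_self_eq_zero hwd hwg hG2 hwm (q := ⊤) (p := 2)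
        (by norm_num) hvtop hwm
      simpa only [FluidPDE.convect] using h
    -- `Q = R s`
    have iN₁w : Integrable (fun x => ⟪FluidPDE.convect (v s) (w s) x, w s x⟫) volume :=
      integrable_of_norm_le_mul_of_lintegral_sq (cN₁.inner cw).aestronglyMeasurable cN₁ cw l2N₁ l2w
        fun x => norm_inner_le_norm _ _
    have iSw : Integrable (fun x => ⟪FluidPDE.convect (w s) (u s) x, w s x⟫) volume :=
      integrable_of_norm_le_mul_of_lintegral_sq (cSx.inner cw).aestronglyMeasurable cSx cw l2S l2w
        fun x => norm_inner_le_norm _ _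
    have hQR : (∫ x, ⟪FluidPDE.convect (v s) (w s) x + FluidPDE.convect (w s) (u s) x, w s x⟫) =
        R s := by
      simp only [hR_def]
      simp_rw [inner_add_left]
      rw [integral_add iN₁w iSw, htrans, zero_add]
    -- Young, for every `λ`
    have hyoung : ∀ l : ℝ, P s + l * R s ≤ ν * (D s + 2 * l * -X s + l ^ 2 * E s) +
        (4 * ν)⁻¹ * ∫ x, ‖FluidPDE.convect (v s) (w s) x + FluidPDE.convect (w s) (u s) x‖ ^ 2 := by
      intro l
      have h := integral_inner_laplacian_add_smul_le_R3 cN hw2 l2N l2w l2Δ hν l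
      rw [hJ, hQR] at h
      simpa only [hP_def, hD_def, hE_def, hX_def] using h
    have hlaw := Literature.Analysis.ODE.dirichletQuotient_law_of_young (V := X s) hEs hν hyoung
    -- `N ≤ 2M²X + 2L²E`
    have hN : (∫ x, ‖FluidPDE.convect (v s) (w s) x + FluidPDE.convect (w s) (u s) x‖ ^ 2) ≤
        2 * M ^ 2 * X s + 2 * L ^ 2 * E s := by
      have iww : Integrable (fun x => ‖w s x‖ ^ 2) volume :=
        integrable_sq_norm_of_lintegral_lt_top cw l2w
      have hpt : ∀ x, ‖FluidPDE.convect (v s) (w s) x + FluidPDE.convect (w s) (u s) x‖ ^ 2 ≤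
          2 * M ^ 2 * FluidPDE.frobeniusNormSq (fderiv ℝ (w s) x) + 2 * L ^ 2 * ‖w s x‖ ^ 2 := by
        intro x
        have a1 := nN₁ s hs x
        have a2 := nS s hs x
        have a3 : ‖fderiv ℝ (w s) x‖ ^ 2 ≤ FluidPDE.frobeniusNormSq (fderiv ℝ (w s) x) :=
          sq_opNorm_le_frobeniusNormSq _
        have a4 : ‖FluidPDE.convect (v s) (w s) x + FluidPDE.convect (w s) (u s) x‖ ≤
            M * ‖fderiv ℝ (w s) x‖ + L * ‖w s x‖ := (norm_add_le _ _).trans (add_le_add a1 a2)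
        have a5 : ‖FluidPDE.convect (v s) (w s) x + FluidPDE.convect (w s) (u s) x‖ ^ 2 ≤
            (M * ‖fderiv ℝ (w s) x‖ + L * ‖w s x‖) ^ 2 :=
          pow_le_pow_left₀ (norm_nonneg _) a4 2
        have a6 : (M * ‖fderiv ℝ (w s) x‖ + L * ‖w s x‖) ^ 2 ≤
            2 * M ^ 2 * ‖fderiv ℝ (w s) x‖ ^ 2 + 2 * L ^ 2 * ‖w s x‖ ^ 2 := by
          nlinarith [sq_nonneg (M * ‖fderiv ℝ (w s) x‖ - L * ‖w s x‖)]
        have a7 : M ^ 2 * ‖fderiv ℝ (w s) x‖ ^ 2 ≤ M ^ 2 * FluidPDE.frobeniusNormSq (fderiv ℝ (w s) x) :=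
          mul_le_mul_of_nonneg_left a3 (sq_nonneg M)
        linarith
      calc (∫ x, ‖FluidPDE.convect (v s) (w s) x + FluidPDE.convect (w s) (u s) x‖ ^ 2)
          ≤ ∫ x, (2 * M ^ 2 * FluidPDE.frobeniusNormSq (fderiv ℝ (w s) x) + 2 * L ^ 2 * ‖w s x‖ ^ 2) :=
            integral_mono (integrable_sq_norm_of_lintegral_lt_top cN l2N)
              ((ifrob.const_mul _).add (iww.const_mul _)) hpt
        _ = 2 * M ^ 2 * X s + 2 * L ^ 2 * E s := by
            rw [integral_add (ifrob.const_mul _) (iww.const_mul _), integral_const_mul,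
              integral_const_mul]
    have hNK : (∫ x, ‖FluidPDE.convect (v s) (w s) x + FluidPDE.convect (w s) (u s) x‖ ^ 2) / (2 * ν) *
        E s ≤ K * (X s + E s) * E s := by
      refine mul_le_mul_of_nonneg_right ?_ hEs.le
      rw [div_le_iff₀ (by positivity : (0 : ℝ) < 2 * ν)]
      have e : K * (X s + E s) * (2 * ν) = 2 * ((M ^ 2 + L ^ 2) * (X s + E s)) := by
        simp only [hK_def]
        field_simp
      rw [e]
      have hXs := hX0 s hs
      have h1 : 0 ≤ M ^ 2 * E s := by positivity
      have h2 : 0 ≤ L ^ 2 * X s := by positivity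
      nlinarith [hN, h1, h2]
    have hrew : V' s * E s - X s * E' s =
        (-(2 * ν * D s) + 2 * P s) * E s - X s * (-(2 * ν * X s) - 2 * R s) := rfl
    rw [hrew]
    exact hlaw.trans hNK
  -- conclusion: `E(T) = 0`, hence `E(t) = 0`, hence `w t = 0`
  have hET : E T = 0 := by
    have hwT : ∀ x, w T x = 0 := fun x => by rw [hwx, hfin, sub_self]
    simp only [hE_def, hwT, norm_zero, sq, mul_zero, integral_zero]
  have hEt : E t = 0 := Literature.Analysis.ODE.eq_zero_of_dirichletQuotient_law hEd hXd hE0 hX0 hK0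
    (by positivity) hlow hquot hET ht
  have cwt : Continuous (w t) := (cd_w t ht).continuous
  have iwt : Integrable (fun x => ‖w t x‖ ^ 2) volume :=
    integrable_sq_norm_of_lintegral_lt_top cwt ((hC₀ t ht).trans_lt ENNReal.coe_lt_top)
  have hae : (fun x => ‖w t x‖ ^ 2) =ᵐ[volume] 0 :=
    (integral_eq_zero_iff_of_nonneg (fun x => sq_nonneg _) iwt).1 hEt
  have hfun : (fun x => ‖w t x‖ ^ 2) = 0 :=
    (Continuous.ae_eq_iff_eq volume (cwt.norm.pow 2) continuous_zero).1 hae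
  funext x
  have hx := congr_fun hfun x
  simp only [Pi.zero_apply, ne_eq, OfNat.ofNat_ne_zero, not_false_eq_true, pow_eq_zero_iff,
    norm_eq_zero] at hx
  rw [hwx] at hx
  exact sub_eq_zero.1 hx

end Main


end Literature.Analysis.FluidPDE

end
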